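import Summits.CriticalPhenomena.Ising3D.TaylorQPolyIntervalList
import Mathlib.Tactic.Linarith
import Mathlib.Tactic.Positivity
import Mathlib.Tactic.Ring
import HarnessLib

/-!
# The δ-expansion of the generalized binomials `σ_i(s) = (-1)^i C(s, i)` around a rational box centre
(cell `pub-ising3x`, seat recog-1 gen 12; gate (g2) — item (L1) of the box-width-robust region rows,
HOME/pub-ising3x-recog-1/gen12/REGION-ON-MARGIN-FUNCTIONAL.md §3/§5)

HONEST FRAMING: lottery ticket; floor = tightest certified 3D Ising CFT bounds; no exact-solution
claim without a proof. Island framing: certified exclusion region at stated derivative order and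
assumptions; not a determination of the 3D Ising critical exponents beyond that.

WHY: the region checks of the γ-certificate take the exponent `s` (= `Δσ`, `Δε`, their mean, …) from a BOX; the landed
list algorithm encloses the twelve numbers `σ_i(s) = (-1)^i C(s, i)` (`i ≤ Λ`) INDEPENDENTLY over the box and then recombines
them through large alternating sums, which loses the sign at box half-width ≈ 5e-5 (MEASURED, gen 12) although the
conditions themselves hold over ± 2e-3. The fix keeps the dependence on `s = s₀ + δ` symbolic to first order:
`σ_i(s₀ + δ) = c_{i,0} + δ·c_{i,1} + δ²·ρ_i(δ)` with EXACT rational `c_{i,0}, c_{i,1}` (Taylor coefficients at the rational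
centre `s₀` of the degree-`i` polynomial `δ ↦ σ_i(s₀ + δ)`) and the algebraic bound `|ρ_i(δ)| ≤ absBound` of the
remaining coefficients for `|δ| ≤ W` — no supremum over an intermediate point is needed because `σ_i` IS a polynomial.
This file: `shiftQL` (rational Taylor shift, twin of `shiftR`), **`sigmaDeltaQ s₀ i`** (the coefficient list in `δ`) with
**`evalR_sigmaDeltaQ`**, the split `evalR_split2`, the kernel-side data `sigmaC0 / sigmaC1 / sigmaRemB` (intervals at
scale `S`) and their memberships **`mem_sigmaC0`**, **`mem_sigmaC1`**, **`mem_sigmaRemB`**, packaged as **`sigma_delta_split`**.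
Elementary. [folklore]
-/

namespace Summit.CriticalPhenomena.Ising3D

open Finset
open Literature.Analysis.ValidatedNumerics Literature.Analysis.ValidatedNumerics.PolyMP
open Literature.Analysis.ValidatedNumerics.NumericsMP (MI)

/-! ### Rational Taylor shift -/

/-- One Horner step of the rational Taylor shift (twin of `shiftStepR`). [folklore] -/
def shiftStepQL (c a : ℚ) (acc : List ℚ) : List ℚ := addQL [a] (addQL (smulQL c acc) (0 :: acc))

/-- Rational Taylor shift: the coefficients (in `y`) of `p(c + y)` (twin of `shiftR`). [folklore] -/
def shiftQL (as : List ℚ) (c : ℚ) : List ℚ := as.foldr (shiftStepQL c) []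

/-- [folklore] -/
theorem map_cast_shiftQL (c : ℚ) : ∀ as : List ℚ,
    ((shiftQL as c).map ((↑) : ℚ → ℝ)) = shiftR (as.map ((↑) : ℚ → ℝ)) (c : ℝ)
  | [] => by simp [shiftQL, shiftR]
  | a :: as => by
      have ih := map_cast_shiftQL c as
      simp only [shiftQL, shiftR, List.foldr_cons, List.map_cons] at ih ⊢
      rw [← ih]
      simp only [shiftStepQL, shiftStepR, map_cast_addQL, map_cast_smulQL, List.map_cons, List.map_nil,
        Rat.cast_zero]

/-! ### `σ_i(s₀ + δ)` as a polynomial in `δ` -/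

/-- The coefficient list (in `δ`, low order first) of `δ ↦ (-1)^i C(s₀ + δ, i)`. [folklore] -/
def sigmaDeltaQ (s₀ : ℚ) (i : ℕ) : List ℚ := smulQL ((-1) ^ i) (shiftQL (chooseCoeffListQ i) s₀)

/-- **`evalR (sigmaDeltaQ s₀ i) δ = (-1)^i C(s₀ + δ, i)`.** [folklore] -/
theorem evalR_sigmaDeltaQ (s₀ : ℚ) (i : ℕ) (δ : ℝ) :
    evalR ((sigmaDeltaQ s₀ i).map ((↑) : ℚ → ℝ)) δ = (-1) ^ i * Ring.choose ((s₀ : ℝ) + δ) i := by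
  rw [sigmaDeltaQ, map_cast_smulQL, evalR_smulR, map_cast_shiftQL, evalR_shiftR, map_cast_chooseCoeffListQ,
    evalR_chooseCoeffList]
  push_cast
  ring

/-- Horner evaluation split after two coefficients: `p(δ) = p₀ + δ·p₁ + δ²·(tail evaluated at δ)`. [folklore] -/
theorem evalR_split2 (L : List ℝ) (δ : ℝ) :
    evalR L δ = L.getD 0 0 + δ * L.getD 1 0 + δ ^ 2 * evalR (L.drop 2) δ := by
  match L with
  | [] => simp
  | [a] => simp [evalR]
  | a :: b :: t => simp only [evalR_cons, List.getD_cons_zero, List.getD_cons_succ, List.drop_succ_cons,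
      List.drop_zero]; ring

/-- [folklore] -/
theorem getD_map_cast (L : List ℚ) (n : ℕ) : (L.map ((↑) : ℚ → ℝ)).getD n 0 = ((L.getD n 0 : ℚ) : ℝ) := by
  have h := List.getD_map (l := L) (n := n) (d := (0 : ℚ)) ((↑) : ℚ → ℝ)
  simpa using h

/-! ### Kernel-side data: the two exact coefficients and the remainder interval -/

/-- Order-0 coefficient `σ_i(s₀)` as a (thin) interval at scale `S`. [folklore] -/
def sigmaC0 (S : ℕ) (s₀ : ℚ) (i : ℕ) : MI := PolyMP.ofRat S ((sigmaDeltaQ s₀ i).getD 0 0)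

/-- Order-1 coefficient `σ_i'(s₀)` as a (thin) interval at scale `S`. [folklore] -/
def sigmaC1 (S : ℕ) (s₀ : ℚ) (i : ℕ) : MI := PolyMP.ofRat S ((sigmaDeltaQ s₀ i).getD 1 0)

/-- The scaled bound of the second-order remainder for `|δ| ≤ W`: `absBound` of the coefficients of order `≥ 2`. [folklore] -/
def sigmaRemBound (S : ℕ) (s₀ W : ℚ) (i : ℕ) : ℤ :=
  absBoundI S W.num W.den (ofRatList S ((sigmaDeltaQ s₀ i).drop 2))

/-- The remainder interval `[-b, b]`. [folklore] -/
def sigmaRemB (S : ℕ) (s₀ W : ℚ) (i : ℕ) : MI := ⟨-sigmaRemBound S s₀ W i, sigmaRemBound S s₀ W i⟩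

/-- The real remainder function `ρ_i(δ)` (evaluation of the order-`≥ 2` tail). [folklore] -/
noncomputable def sigmaRho (s₀ : ℚ) (i : ℕ) (δ : ℝ) : ℝ := evalR (((sigmaDeltaQ s₀ i).drop 2).map ((↑) : ℚ → ℝ)) δ

/-- **The split**: `(-1)^i C(s₀ + δ, i) = c₀ + δ c₁ + δ² ρ_i(δ)`. [folklore] -/
theorem sigma_eq_split (s₀ : ℚ) (i : ℕ) (δ : ℝ) :
    (-1) ^ i * Ring.choose ((s₀ : ℝ) + δ) i =
      (((sigmaDeltaQ s₀ i).getD 0 0 : ℚ) : ℝ) + δ * (((sigmaDeltaQ s₀ i).getD 1 0 : ℚ) : ℝ) + δ ^ 2 * sigmaRho s₀ i δ := by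
  rw [← evalR_sigmaDeltaQ, evalR_split2, getD_map_cast, getD_map_cast, sigmaRho, List.map_drop]

/-- [folklore] -/
theorem mem_sigmaC0 (S : ℕ) (s₀ : ℚ) (i : ℕ) :
    MI.mem S ((((sigmaDeltaQ s₀ i).getD 0 0 : ℚ) : ℝ)) (sigmaC0 S s₀ i) := mem_ofRat S _

/-- [folklore] -/
theorem mem_sigmaC1 (S : ℕ) (s₀ : ℚ) (i : ℕ) :
    MI.mem S ((((sigmaDeltaQ s₀ i).getD 1 0 : ℚ) : ℝ)) (sigmaC1 S s₀ i) := mem_ofRat S _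

/-- **The remainder lies in `[-b, b]`** for `|δ| ≤ W` (`W ≥ 0`). [folklore] -/
theorem mem_sigmaRemB (S : ℕ) (s₀ : ℚ) {W : ℚ} (hW : 0 ≤ W) (i : ℕ) {δ : ℝ} (hδ : |δ| ≤ W) :
    MI.mem S (sigmaRho s₀ i δ) (sigmaRemB S s₀ W i) := by
  have hWn : 0 ≤ W.num := Rat.num_nonneg.mpr hW
  have hpm := pmem_ofRatList S ((sigmaDeltaQ s₀ i).drop 2)
  have h1 : |sigmaRho s₀ i δ| ≤ absBoundR (((sigmaDeltaQ s₀ i).drop 2).map ((↑) : ℚ → ℝ)) ((W.num : ℝ) / W.den) := by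
    refine abs_evalR_le_absBoundR _ (hδ.trans (le_of_eq ?_))
    exact ratCast_eq_num_div_den W
  have h2 := absBoundR_le_absBoundI hWn W.den_pos hpm
  have hS0 : (0 : ℝ) ≤ S := by exact_mod_cast Nat.zero_le S
  have h3 : |sigmaRho s₀ i δ| * S ≤ (sigmaRemBound S s₀ W i : ℝ) := by
    rw [sigmaRemBound]
    exact (mul_le_mul_of_nonneg_right h1 hS0).trans h2
  rw [sigmaRemB, MI.mem]
  push_cast
  constructor
  · nlinarith [neg_abs_le (sigmaRho s₀ i δ), abs_nonneg (sigmaRho s₀ i δ)]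
  · nlinarith [le_abs_self (sigmaRho s₀ i δ)]

/-- **Package**: for every `i` and every `|δ| ≤ W` the generalized binomial splits with kernel-checkable enclosures of the
three parts (`C0`, `C1` thin, the remainder in `[-b_i, b_i]`). [folklore] -/
theorem sigma_delta_split {S : ℕ} (s₀ : ℚ) {W : ℚ} (hW : 0 ≤ W) {δ : ℝ} (hδ : |δ| ≤ W) (i : ℕ) :
    ∃ c₀ c₁ ρ : ℝ, (-1) ^ i * Ring.choose ((s₀ : ℝ) + δ) i = c₀ + δ * c₁ + δ ^ 2 * ρ ∧
      MI.mem S c₀ (sigmaC0 S s₀ i) ∧ MI.mem S c₁ (sigmaC1 S s₀ i) ∧ MI.mem S ρ (sigmaRemB S s₀ W i) :=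
  ⟨_, _, _, sigma_eq_split s₀ i δ, mem_sigmaC0 S s₀ i, mem_sigmaC1 S s₀ i, mem_sigmaRemB S s₀ hW i hδ⟩

/-! ### Fixtures (kernel evaluation of the data; values cross-checked against the Python prototype `delta_rows.py`) -/

/-- `σ_2(s₀+δ) = C(s₀+δ, 2) = (s₀+δ)(s₀+δ-1)/2`: at `s₀ = 1/2` the coefficients are `[-1/8, 0, 1/2]`. [folklore] -/
theorem sigmaDeltaQ_two_half : sigmaDeltaQ (1 / 2) 2 = [-1 / 8, 0, 1 / 2] := by
  decide +kernel

/-- `σ_3` at `s₀ = 1/2`: `-(C(½+δ,3)) = -[(½+δ)(δ-½)(δ-3/2)]/6` has coefficients `[-1/16, 1/24, 1/4, -1/6]`. [folklore] -/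
theorem sigmaDeltaQ_three_half : sigmaDeltaQ (1 / 2) 3 = [-1 / 16, 1 / 24, 1 / 4, -1 / 6] := by
  decide +kernel

/-- The remainder bound of `σ_3` at `s₀ = 1/2`, `W = 1/100`, scale `2^20`: `absBound([1/4, -1/6], 1/100)·S`
`= (1/4 + (1/100)(1/6))·2^20` rounded up coefficientwise. [folklore] -/
theorem sigmaRemBound_three_half : sigmaRemBound (2 ^ 20) (1 / 2) (1 / 100) 3 = 263892 := by
  decide +kernel

end Summit.CriticalPhenomena.Ising3D
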